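import Mathlib
import Summits.NavierStokesRegularity.NavierStokesRegularity.Theorems.ThreadingFluxHorizonTowerFiniteTowerDefs
import Summits.NavierStokesRegularity.NavierStokesRegularity.Theorems.ThreadingFluxHorizonTowerFiniteTowerFourSixEight
import HarnessLib

/-!
# Crux `PoloidalLiouville` (stmt-NavierStokesRegularity-1222), crux idea «horizon-threading-tower» (ns-idea-15):
# FINITE TOWERS AT ORDER ONE, V — THM G BY NAME (the tower `{4, 6, 8}`)

Support file (`--supports stmt-NavierStokesRegularity-1222`, helper; cell `ns-wall-extremal`, width hand ns-wall-eng-3 g5; 0 kit).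
Closes BY NAME the typed statement `FourSixEightHorizonTowerZonality` of `Theorems/ThreadingFluxHorizonTowerFiniteTowerDefs.lean` (append
V) with the kernel theorem `finiteTower_zonalForm_of_fourSixEight` (`Theorems/ThreadingFluxHorizonTowerFiniteTowerFourSixEight.lean`).

HONEST LABEL: one cell (the third all-one-parity, non-coprime-top cell) of the crux-idea CONJECTURE `HorizonTowerZonality` at ORDER
ONE; `{2,4,8}`, `{4,6,8}`, `{1,3,9}`, … and the general tower stay OPEN; `PoloidalLiouville` (1222), `UnthreadedRigidity` (27585) OPEN;
W1 movement 0; NS regularity NOT proved.  [folklore]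
-/

-- the summit and its single sub-problem share the name (CONVENTIONS §1)
set_option linter.dupNamespace false

noncomputable section

namespace Summit.NavierStokesRegularity.NavierStokesRegularity.Theorems.PoloidalLiouville.HorizonTower

/-- ★★ **THM G BY NAME**: `FourSixEightHorizonTowerZonality` holds — the scale-free tower `{4, 6, 8}` is coaxially zonal at order one.
[folklore] -/
theorem fourSixEightHorizonTowerZonality : FourSixEightHorizonTowerZonality :=
  fun _ _ _ hA hhomA hharmA hB hhomB hharmB hC hhomC hharmC hB0 hC0 hL1 =>
    finiteTower_zonalForm_of_fourSixEight hA hhomA hharmA hB hhomB hharmB hC hhomC hharmC hB0 hC0 hL1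

end Summit.NavierStokesRegularity.NavierStokesRegularity.Theorems.PoloidalLiouville.HorizonTower

end
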